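/-
Copyright (c) 2026 the pub-hodgecm-mathlib formalisation cell (harness21).  Prover seat hodgecm-mathlib-K2E1-p11 (g6), Track B ∕ K2-LIT, h413 = `stmt-HodgeConjecture-24833`,
R90-TF section S8 «ContSpec-n½», the `hsrc` supplier estate, census `R90/S8/CENSUS-UnfoldingLetterFree.K2E1-p11-g6.md` f7bfa6fc755d5846 item (d2) (S8 dealer R90-CS-plan (g4),
S8-R282 «THEN (d2) `hsp` token (M, degree-one bridge ι_w : L⁺_v ≅ L_w)»): THE GOOD SPLIT PLACE WEIGHT — at a split good place `v` of `L⁺` (`w ≠ w̄ = c⁻¹w` above it) the weight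
`ω_v := c₁·c₂` built from ★ p865317's torus-entry functions `α₁ α₂` over `L_w`, PULLED BACK along the degree-one isomorphism ★ `ι_w : L⁺_v ≃+* L_w`, (i) HAS the `χ`-local mean
`hsp` of ★ p864821 (★ `chiLocalMean_eq_splitToken_of_torusEntries`, symmetric token), (ii) IS the «on» reading of ★ p864965 `hΩ_of_localReadings` at `v`, (iii) is `1` on `𝒪_v³`.
-/
import Summits.HodgeConjecture.HodgeConjecture.Theorems.K2E1ChiGoodSplitReadingU3              -- ★ p865317 (this seat): `exists_goodSplit_reading` (the split «on» reading with the brick's `α₁ α₂` over `L_w`)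
import Summits.HodgeConjecture.HodgeConjecture.Theorems.K2E1ChiLocalMeansOfShellU3Letters        -- ★ (R90-CS-p03): brings ★ `chiLocalMean_eq_splitToken_of_torusEntries`, dictionary `valued_eq_one_of_normAbs_eq_one`, `normAbs_eq_one_of_valued_eq_one`, `normAbs_heckeUniformizer`
import Summits.HodgeConjecture.HodgeConjecture.Theorems.K2E1IntertwiningLocalFactorU3HeightSplit -- ★ (K2E2-p12): `normAbs_toPlace_of_split` (`‖ι_w y‖_w = ‖y‖_v`), `smul_galInv_ne`
import Literature.NumberTheory.Automorphic.AdicCompletionDegreeOnePlaceEquiv                    -- ★ `adicCompletionEquivOfDegreeOne`, `unitsAdicCompletionEquivOfDegreeOne`, `ramificationIdx_eq_one_and_inertiaDeg_eq_one_of_smul_ne`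
import HarnessLib

/-!
# K2·E1 ∕ R90·S8 — `K2E1ChiGoodSplitWeightU3`: THE GOOD SPLIT PLACE WEIGHT `ω_v` — ★ p864821's `hsp` token, ★ p864965's «on» reading and `hω1` AT ONE SPLIT PLACE, from ★ p865317
# along the degree-one bridge `ι_w : L⁺_v ≅ L_w`

Cell `pub/hodgecm-mathlib`, crux h413 = `stmt-HodgeConjecture-24833`, route of record `HCCMUnconditional`; R90-TF section S8 «ContSpec-n½», road R2-χ₃ ((V)∕(R)′ OF RECORD row `hsrc`,
F-A32 (R1)), the LETTER-FREE `hΩ` core of ★ p864821 `hsrc_of_record_at_basePoint_of_core`.  THEOREMS ONLY (no `def`, no `instance`, no `notation`, no named-fact hypothesis, no `sorry`;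
default heartbeats); lane `--supports stmt-HodgeConjecture-24833 --as helper` (count-neutral).  Closes no socket.

THE MATHEMATICS ([CasselsFrohlichANT1967] Ch. II §10, Ch. VII Prop. 1.2; [FrohlichTaylor1990] Ch. III §1 (1.14)(a); [TateThesis1967] §2.3, §2.5; [Langlands1971] §3; [Rogawski1990]
§4.5 p. 45, §13.9 p. 229).  Let `v` be a finite place of `L⁺` split in `L`, `w ∣ v` (`c·w ≠ w`, `w̄ := c⁻¹w`).  Then `e(w|v) = f(w|v) = 1` (★ `ramificationIdx_eq_one_and_inertiaDeg_eq_one_of_smul_ne`)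
and `ι_w : L⁺_v → L_w` (★ `toPlace v w`) is an isomorphism of valued fields (★ `adicCompletionEquivOfDegreeOne`, `‖ι_w y‖_w = ‖y‖_v` ★ `normAbs_toPlace_of_split`) with `ι_w(δ_w) = δ`
(★ `toPlace_splitSqrt`, `δ_w :=` ★ `splitSqrt … v w`).  ★ p865317 `exists_goodSplit_reading` reads the big cell `ι(w₀)·n(X)·b₁` at `v` through the Iwasawa decomposition of
`Φ₃·n(ι_w(x|_v))` in `GL₃(L_w)`: local units `t_w = α₂(q)`, `t_{w̄} = c⁻¹_*(α₁(q))`, `q = ι_w(x|_v)`, with `‖α₁ q‖·A(q) = 1`, `‖α₂ q‖·B(q) = 1`, `A, B` the Gindikin–Karpelevich maxima over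
`L_w` (base `δ`).  PULL BACK along `ι_w`: `α_j^♭(p) := ι_w⁻¹(α_j(ι_w p)) ∈ (L⁺_v)^×`, and the unramified characters of `(L⁺_v)^×` `χ_A := φ_{w̄} ∘ c⁻¹_* ∘ ι_w`, `χ_B := φ_w ∘ ι_w`
(`φ` unramified at `w, w̄`; `χ_A(ϖ_v) = φ(ϖ_{w̄})`, `χ_B(ϖ_v) = φ(ϖ_w)` since `ι_w`, `c⁻¹_*` preserve valuations); the WEIGHT `ω_v(p) := c₁(p)·c₂(p)`, `c₁ := 𝟙{A ≤ 1} + 𝟙{A > 1}·χ_A(α₁^♭)`,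
`c₂ := 𝟙{B ≤ 1} + 𝟙{B > 1}·χ_B(α₂^♭)` (maxima over `L⁺_v`, base `δ_w`; `= A, B ∘ ι_w`).  THEN: (i) ★ `chiLocalMean_eq_splitToken_of_torusEntries` (whose tokens `e₁ e₂` are free) gives
`ν(𝒪_v³)⁻¹ ∫ ω_v·Q_v^{−z} = T(φ(ϖ_{w̄}), φ(ϖ_w)) = T(φ(ϖ_w), φ(ϖ_{w̄}))` (`T` symmetric) — ★ p864821's `hsp` at `v` for BOTH `w' ∣ v` (`galInv (galInv w) = w`); (ii) for every `x`,
`ω_v(x|_v) = φ_w(t_w)·φ_{w̄}(t_{w̄})` (on `{A = 1}`: `‖α₁‖ = 1` so `φ_{w̄}(c⁻¹_* α₁) = 1` by unramifiedness; same for `B`) — the «on» disjunct of ★ p864965 `hΩ_of_localReadings`; (iii) on `𝒪_v³`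
all of `x, y, z, z − xy` are integral (`|δ_w|_v = |2|_v = 1`), so `A = B = 1` and `ω_v = 1` — ★ p864821's `hω1` at `v`.
HONEST NOTE (pairing): ★ `hsp_of_torusEntries`' `hT` labels `(α₁, A) ↔ χ₁(ϖ) = φ(ϖ_w)`, whereas the brick's reading gives `(α₁, A) ↔ φ_{w̄}`; the clause `hsp` itself is reached here
through the SYMMETRIC token of ★ `chiLocalMean_eq_splitToken_of_torusEntries` (tokens swapped, `ring`), so no statement upstream changes.
* §1 bridge lemmas at a split place (`χ ∘ ι_w` unramified, values at uniformizers, the Gindikin–Karpelevich maxima under `ι_w`, integrality on the box).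
* §2 HEAD **`exists_goodSplit_weight`** — `∃ ω_v`, (i) `hsp` at `v` ∧ (ii) «on» reading at `v` ∧ (iii) `ω_v = 1` on `𝒪_v³`.
HONEST LABEL: HC_CM is proved only modulo the 7 printed citations (2 remaining named inputs: hLiu418 = `stmt-HodgeConjecture-24832`, h413 = `stmt-HodgeConjecture-24833`) until rung 0
closes; REL ≠ ★ ≠ BUILT; unconditional; asserts no named fact, closes no socket; with ★ p865184 (inert) and ★ p865059 (bad) every place's weight is now NAMED; remaining for the
letter-free core: `hωc` (continuity), the assembler's finite-support clause, (e) the `Θ`-constant; count-neutral.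

## References
* [CasselsFrohlichANT1967] J. W. S. Cassels, A. Fröhlich (eds.), *Algebraic Number Theory* (1967), Ch. II §7, §10; Ch. VII Prop. 1.2.
* [FrohlichTaylor1990] A. Fröhlich, M. J. Taylor, *Algebraic number theory* (1990), Ch. III §1 (1.14)(a).
* [TateThesis1967] J. Tate, *Fourier analysis in number fields and Hecke's zeta-functions* (1967), §2.3, §2.5.
* [Langlands1971] R. P. Langlands, *Euler Products* (1971), §3.
* [Rogawski1990] J. D. Rogawski, *Automorphic Representations of Unitary Groups in Three Variables*, Ann. of Math. Stud. 123 (1990), §4.5 p. 45, §13.9 p. 229.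
-/

set_option autoImplicit false
set_option linter.dupNamespace false  -- the mandated namespace repeats the summit's segment (`HodgeConjecture.HodgeConjecture`)

noncomputable section

open MeasureTheory NumberField IsDedekindDomain Filter Set Function
open scoped NNReal Matrix
open Literature.NumberTheory.GaloisRepresentations Literature.NumberTheory.GaloisRepresentations.HeckeCharacter
open Literature.NumberTheory.GaloisRepresentations.IsNonarchimedeanLocalField
open Literature.NumberTheory.Automorphic Literature.NumberTheory.Automorphic.UnitaryGroup AdelicGroupData
open Literature.NumberTheory.Automorphic.Arthur2013.Leaves.TECR
open Literature.NumberTheory.GelbartRogawski1991.UnitaryDualPair.LocalSplitting (splitSqrt toPlace_splitSqrt valued_toPlace_of_split)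
open Summit.HodgeConjecture.HodgeConjecture.Cruxes.H413.K2E1ChiGoodSplitReadingU3 (exists_goodSplit_reading)
open Summit.HodgeConjecture.HodgeConjecture.Cruxes.H413.K2E1ChiLocalMeansOfShellU3
  (chiLocalMean_eq_splitToken_of_torusEntries valued_eq_one_of_normAbs_eq_one normAbs_eq_one_of_valued_eq_one normAbs_heckeUniformizer localComponent_eq_one_of_normAbs_eq_one)
open Summit.HodgeConjecture.HodgeConjecture.Cruxes.H413.K2E1IntertwiningLocalFactorU3HeightSplit (normAbs_toPlace_of_split smul_galInv_ne)

namespace Summit.HodgeConjecture.HodgeConjecture.Cruxes.H413.K2E1ChiGoodSplitWeightU3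

/-! ## §1 Bridge lemmas at a split place `w ∣ v` (`c·w ≠ w`) -/

section Bridge

variable (L : Type) [Field L] [NumberField L] [IsCMField L] {v : HeightOneSpectrum (𝓞 ↥(maximalRealSubfield L))}

/-- **`φ_w ∘ ι_w` kills the units of `L⁺_v`** at a split place where `φ` is unramified (`|ι_w u|_w = |u|_v = 1` ★ `valued_toPlace_of_split`). [cite: TateThesis1967, §2.3]
[cite: CasselsFrohlichANT1967, Ch. II §10] -/
theorem localComponent_map_toPlace_eq_one {φ : HeckeCharacter L} (w : PlacesOver L v) (hw : IsCMField.complexConj L • w.1 ≠ w.1) (hur : φ.IsUnramifiedAt w.1)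
    (u : (v.adicCompletion ↥(maximalRealSubfield L))ˣ) (hu : normAbs (v.adicCompletion ↥(maximalRealSubfield L)) (u : v.adicCompletion ↥(maximalRealSubfield L)) = 1) :
    φ.localComponent w.1 (Units.map (toPlace v w).toMonoidHom u) = 1 := by
  haveI : Algebra.IsQuadraticExtension ↥(maximalRealSubfield L) L := IsCMField.isQuadraticExtension L
  refine HeckeCharacter.isUnramifiedAt_iff_forall_valued_eq_one.1 hur _ ?_
  rw [Units.coe_map, RingHom.toMonoidHom_eq_coe, MonoidHom.coe_coe, valued_toPlace_of_split ↥(maximalRealSubfield L) L (IsCMField.complexConj L) v w hw]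
  exact valued_eq_one_of_normAbs_eq_one v hu

/-- **`φ_{w̄} ∘ c⁻¹_* ∘ ι_w` kills the units of `L⁺_v`** (`c⁻¹_*` preserves valuations, ★ `valued_galAdicCompletionMap`). [cite: TateThesis1967, §2.3] [cite: CasselsFrohlichANT1967, Ch. VII §1.1] -/
theorem localComponent_galInv_map_toPlace_eq_one {φ : HeckeCharacter L} (w : PlacesOver L v) (hw : IsCMField.complexConj L • w.1 ≠ w.1)
    (hur : φ.IsUnramifiedAt (PlacesOver.galInv (IsCMField.complexConj L) w).1)
    (u : (v.adicCompletion ↥(maximalRealSubfield L))ˣ) (hu : normAbs (v.adicCompletion ↥(maximalRealSubfield L)) (u : v.adicCompletion ↥(maximalRealSubfield L)) = 1) :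
    φ.localComponent (PlacesOver.galInv (IsCMField.complexConj L) w).1
      (Units.map ((galAdicCompletionMap (IsCMField.complexConj L)⁻¹ (rfl : (IsCMField.complexConj L)⁻¹ • w.1 = (PlacesOver.galInv (IsCMField.complexConj L) w).1)).toMonoidHom.comp
        (toPlace v w).toMonoidHom) u) = 1 := by
  haveI : Algebra.IsQuadraticExtension ↥(maximalRealSubfield L) L := IsCMField.isQuadraticExtension L
  refine HeckeCharacter.isUnramifiedAt_iff_forall_valued_eq_one.1 hur _ ?_
  rw [Units.coe_map, MonoidHom.coe_comp, Function.comp_apply, RingHom.toMonoidHom_eq_coe, MonoidHom.coe_coe, RingHom.toMonoidHom_eq_coe, MonoidHom.coe_coe,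
    valued_galAdicCompletionMap, valued_toPlace_of_split ↥(maximalRealSubfield L) L (IsCMField.complexConj L) v w hw]
  exact valued_eq_one_of_normAbs_eq_one v hu

/-- **`(φ_w ∘ ι_w)(ϖ_v) = φ(ϖ_w)`**: a uniformizer of `L⁺_v` maps to a uniformizer of `L_w` at a split place (`e(w|v) = 1`), and `φ` unramified at `w` has a well-defined value there
(★ `localComponent_eq_valueAtUniformizer`). [cite: TateThesis1967, §2.5] [cite: CasselsFrohlichANT1967, Ch. II §10] -/
theorem localComponent_map_toPlace_uniformizer {φ : HeckeCharacter L} (w : PlacesOver L v) (hw : IsCMField.complexConj L • w.1 ≠ w.1) (hur : φ.IsUnramifiedAt w.1)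
    {π : (v.adicCompletion ↥(maximalRealSubfield L))ˣ} (hπ : Valued.v (π : v.adicCompletion ↥(maximalRealSubfield L)) = WithZero.exp (-1 : ℤ)) :
    ((φ.localComponent w.1 (Units.map (toPlace v w).toMonoidHom π) : ℂˣ) : ℂ) = φ.valueAtUniformizer w.1 := by
  haveI : Algebra.IsQuadraticExtension ↥(maximalRealSubfield L) L := IsCMField.isQuadraticExtension L
  refine localComponent_eq_valueAtUniformizer hur ?_
  rw [Units.coe_map, RingHom.toMonoidHom_eq_coe, MonoidHom.coe_coe, valued_toPlace_of_split ↥(maximalRealSubfield L) L (IsCMField.complexConj L) v w hw, hπ]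

/-- **`(φ_{w̄} ∘ c⁻¹_* ∘ ι_w)(ϖ_v) = φ(ϖ_{w̄})`.** [cite: TateThesis1967, §2.5] [cite: CasselsFrohlichANT1967, Ch. VII §1.1] -/
theorem localComponent_galInv_map_toPlace_uniformizer {φ : HeckeCharacter L} (w : PlacesOver L v) (hw : IsCMField.complexConj L • w.1 ≠ w.1)
    (hur : φ.IsUnramifiedAt (PlacesOver.galInv (IsCMField.complexConj L) w).1)
    {π : (v.adicCompletion ↥(maximalRealSubfield L))ˣ} (hπ : Valued.v (π : v.adicCompletion ↥(maximalRealSubfield L)) = WithZero.exp (-1 : ℤ)) :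
    ((φ.localComponent (PlacesOver.galInv (IsCMField.complexConj L) w).1
      (Units.map ((galAdicCompletionMap (IsCMField.complexConj L)⁻¹ (rfl : (IsCMField.complexConj L)⁻¹ • w.1 = (PlacesOver.galInv (IsCMField.complexConj L) w).1)).toMonoidHom.comp
        (toPlace v w).toMonoidHom) π) : ℂˣ) : ℂ) = φ.valueAtUniformizer (PlacesOver.galInv (IsCMField.complexConj L) w).1 := by
  haveI : Algebra.IsQuadraticExtension ↥(maximalRealSubfield L) L := IsCMField.isQuadraticExtension L
  refine localComponent_eq_valueAtUniformizer hur ?_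
  rw [Units.coe_map, MonoidHom.coe_comp, Function.comp_apply, RingHom.toMonoidHom_eq_coe, MonoidHom.coe_coe, RingHom.toMonoidHom_eq_coe, MonoidHom.coe_coe,
    valued_galAdicCompletionMap, valued_toPlace_of_split ↥(maximalRealSubfield L) L (IsCMField.complexConj L) v w hw, hπ]

/-- On `K_u`: `|y|_u ≤ 1 ⟹ ‖y‖ ≤ 1` in `ℝ` (★ `normAbs_le_normAbs_iff_valued` against `1`). [cite: CasselsFrohlichANT1967, Ch. II §7] -/
theorem coe_normAbs_le_one_of_valued_le_one {K : Type} [Field K] [NumberField K] (u : HeightOneSpectrum (𝓞 K)) {y : u.adicCompletion K} (hy : Valued.v y ≤ 1) :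
    ((normAbs (u.adicCompletion K) y : ℝ≥0) : ℝ) ≤ 1 := by
  have h : normAbs (u.adicCompletion K) y ≤ normAbs (u.adicCompletion K) 1 := by
    rw [normAbs_le_normAbs_iff_valued, map_one]
    exact hy
  rw [map_one] at h
  exact_mod_cast h

variable {δ : L} (hcδ : IsCMField.complexConj L δ = -δ) (hδ : δ ≠ 0) {d : ↥(maximalRealSubfield L)} (hd : δ * δ = algebraMap ↥(maximalRealSubfield L) L d)

include hd in
/-- **The Gindikin–Karpelevich maximum `A` under `ι_w`**: `max(1, |x|_v, |z|_v) = max(1, ‖ι_w x‖_w, ‖ι_w z‖_w)` with `ι_w(p₀ + δ_w p₁) = q₀ + δ q₁`, `ι_w(δ_w p₂ − ½ x x̄) = δ q₂ − ½ X X̄`,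
`q = ι_w ∘ p` (★ `normAbs_toPlace_of_split`, ★ `toPlace_splitSqrt`). [cite: CasselsFrohlichANT1967, Ch. II §10] [cite: Langlands1971, §3] -/
theorem gkMaxA_eq_toPlace (w : PlacesOver L v) (hw : IsCMField.complexConj L • w.1 ≠ w.1) (p : Fin 3 → v.adicCompletion ↥(maximalRealSubfield L)) :
    max 1 (max ((normAbs (v.adicCompletion ↥(maximalRealSubfield L)) (p 0 + splitSqrt ↥(maximalRealSubfield L) L (IsCMField.complexConj L) hcδ hδ v w * p 1) : ℝ≥0) : ℝ)
        ((normAbs (v.adicCompletion ↥(maximalRealSubfield L)) (splitSqrt ↥(maximalRealSubfield L) L (IsCMField.complexConj L) hcδ hδ v w * p 2 -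
          2⁻¹ * (p 0 + splitSqrt ↥(maximalRealSubfield L) L (IsCMField.complexConj L) hcδ hδ v w * p 1) * (p 0 - splitSqrt ↥(maximalRealSubfield L) L (IsCMField.complexConj L) hcδ hδ v w * p 1)) : ℝ≥0) : ℝ)) =
      max 1 (max ((normAbs (w.1.adicCompletion L) (toPlace v w (p 0) + algebraMap L (w.1.adicCompletion L) δ * toPlace v w (p 1)) : ℝ≥0) : ℝ)
        ((normAbs (w.1.adicCompletion L) (algebraMap L (w.1.adicCompletion L) δ * toPlace v w (p 2) -
          2⁻¹ * (toPlace v w (p 0) + algebraMap L (w.1.adicCompletion L) δ * toPlace v w (p 1)) * (toPlace v w (p 0) - algebraMap L (w.1.adicCompletion L) δ * toPlace v w (p 1))) : ℝ≥0) : ℝ)) := by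
  haveI : Algebra.IsQuadraticExtension ↥(maximalRealSubfield L) L := IsCMField.isQuadraticExtension L
  rw [← normAbs_toPlace_of_split L (IsCMField.complexConj L) v w hw (p 0 + _), ← normAbs_toPlace_of_split L (IsCMField.complexConj L) v w hw (_ * p 2 - _)]
  simp only [map_add, map_sub, map_mul, map_inv₀, map_ofNat, toPlace_splitSqrt ↥(maximalRealSubfield L) L (IsCMField.complexConj L) hcδ hδ hd v w hw]

include hd in
/-- **The Gindikin–Karpelevich maximum `B` under `ι_w`**: `max(1, |y|_v, |z − x y|_v) = max(1, ‖ι_w y‖_w, ‖ι_w (z − x y)‖_w)`, `y = −(p₀ − δ_w p₁)`. [cite: CasselsFrohlichANT1967, Ch. II §10]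
[cite: Langlands1971, §3] -/
theorem gkMaxB_eq_toPlace (w : PlacesOver L v) (hw : IsCMField.complexConj L • w.1 ≠ w.1) (p : Fin 3 → v.adicCompletion ↥(maximalRealSubfield L)) :
    max 1 (max ((normAbs (v.adicCompletion ↥(maximalRealSubfield L)) (-(p 0 - splitSqrt ↥(maximalRealSubfield L) L (IsCMField.complexConj L) hcδ hδ v w * p 1)) : ℝ≥0) : ℝ)
        ((normAbs (v.adicCompletion ↥(maximalRealSubfield L)) (splitSqrt ↥(maximalRealSubfield L) L (IsCMField.complexConj L) hcδ hδ v w * p 2 -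
            2⁻¹ * (p 0 + splitSqrt ↥(maximalRealSubfield L) L (IsCMField.complexConj L) hcδ hδ v w * p 1) * (p 0 - splitSqrt ↥(maximalRealSubfield L) L (IsCMField.complexConj L) hcδ hδ v w * p 1) -
          (p 0 + splitSqrt ↥(maximalRealSubfield L) L (IsCMField.complexConj L) hcδ hδ v w * p 1) * (-(p 0 - splitSqrt ↥(maximalRealSubfield L) L (IsCMField.complexConj L) hcδ hδ v w * p 1))) : ℝ≥0) : ℝ)) =
      max 1 (max ((normAbs (w.1.adicCompletion L) (-(toPlace v w (p 0) - algebraMap L (w.1.adicCompletion L) δ * toPlace v w (p 1))) : ℝ≥0) : ℝ)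
        ((normAbs (w.1.adicCompletion L) (algebraMap L (w.1.adicCompletion L) δ * toPlace v w (p 2) -
            2⁻¹ * (toPlace v w (p 0) + algebraMap L (w.1.adicCompletion L) δ * toPlace v w (p 1)) * (toPlace v w (p 0) - algebraMap L (w.1.adicCompletion L) δ * toPlace v w (p 1)) -
          (toPlace v w (p 0) + algebraMap L (w.1.adicCompletion L) δ * toPlace v w (p 1)) * (-(toPlace v w (p 0) - algebraMap L (w.1.adicCompletion L) δ * toPlace v w (p 1)))) : ℝ≥0) : ℝ)) := by
  haveI : Algebra.IsQuadraticExtension ↥(maximalRealSubfield L) L := IsCMField.isQuadraticExtension L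
  rw [← normAbs_toPlace_of_split L (IsCMField.complexConj L) v w hw (-(p 0 - _)), ← normAbs_toPlace_of_split L (IsCMField.complexConj L) v w hw (_ * p 2 - _ - _)]
  simp only [map_add, map_sub, map_mul, map_neg, map_inv₀, map_ofNat, toPlace_splitSqrt ↥(maximalRealSubfield L) L (IsCMField.complexConj L) hcδ hδ hd v w hw]

include hd in
/-- **On the box `𝒪_v³` both Gindikin–Karpelevich maxima are `1`** at a good split place (`|2|_v = 1`, `|δ|_w = 1` hence `|δ_w|_v = 1` ★ `valued_toPlace_of_split` + ★ `toPlace_splitSqrt`): all of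
`x, y, z, z − x y` are `v`-integral. [cite: CasselsFrohlichANT1967, Ch. II §10] [cite: Langlands1971, §3] -/
theorem gkMax_eq_one_of_mem_integralBox (w : PlacesOver L v) (hw : IsCMField.complexConj L • w.1 ≠ w.1)
    (h2 : Valued.v (2 : v.adicCompletion ↥(maximalRealSubfield L)) = 1) (hδu : Valued.v (algebraMap L (LocalRing L v) δ w) = 1)
    {p : Fin 3 → v.adicCompletion ↥(maximalRealSubfield L)} (hp : p ∈ integralBox ↥(maximalRealSubfield L) (Fin 3) v) :
    max 1 (max ((normAbs (v.adicCompletion ↥(maximalRealSubfield L)) (p 0 + splitSqrt ↥(maximalRealSubfield L) L (IsCMField.complexConj L) hcδ hδ v w * p 1) : ℝ≥0) : ℝ)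
        ((normAbs (v.adicCompletion ↥(maximalRealSubfield L)) (splitSqrt ↥(maximalRealSubfield L) L (IsCMField.complexConj L) hcδ hδ v w * p 2 -
          2⁻¹ * (p 0 + splitSqrt ↥(maximalRealSubfield L) L (IsCMField.complexConj L) hcδ hδ v w * p 1) * (p 0 - splitSqrt ↥(maximalRealSubfield L) L (IsCMField.complexConj L) hcδ hδ v w * p 1)) : ℝ≥0) : ℝ)) = 1 ∧
    max 1 (max ((normAbs (v.adicCompletion ↥(maximalRealSubfield L)) (-(p 0 - splitSqrt ↥(maximalRealSubfield L) L (IsCMField.complexConj L) hcδ hδ v w * p 1)) : ℝ≥0) : ℝ)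
        ((normAbs (v.adicCompletion ↥(maximalRealSubfield L)) (splitSqrt ↥(maximalRealSubfield L) L (IsCMField.complexConj L) hcδ hδ v w * p 2 -
            2⁻¹ * (p 0 + splitSqrt ↥(maximalRealSubfield L) L (IsCMField.complexConj L) hcδ hδ v w * p 1) * (p 0 - splitSqrt ↥(maximalRealSubfield L) L (IsCMField.complexConj L) hcδ hδ v w * p 1) -
          (p 0 + splitSqrt ↥(maximalRealSubfield L) L (IsCMField.complexConj L) hcδ hδ v w * p 1) * (-(p 0 - splitSqrt ↥(maximalRealSubfield L) L (IsCMField.complexConj L) hcδ hδ v w * p 1))) : ℝ≥0) : ℝ)) = 1 := by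
  haveI : Algebra.IsQuadraticExtension ↥(maximalRealSubfield L) L := IsCMField.isQuadraticExtension L
  -- everything in sight is `v`-integral
  have hs : Valued.v (splitSqrt ↥(maximalRealSubfield L) L (IsCMField.complexConj L) hcδ hδ v w) ≤ 1 := by
    rw [← valued_toPlace_of_split ↥(maximalRealSubfield L) L (IsCMField.complexConj L) v w hw, toPlace_splitSqrt ↥(maximalRealSubfield L) L (IsCMField.complexConj L) hcδ hδ hd v w hw]
    exact le_of_eq hδu
  have h2' : Valued.v (2⁻¹ : v.adicCompletion ↥(maximalRealSubfield L)) ≤ 1 := by rw [map_inv₀, h2, inv_one]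
  have hpi : ∀ i, Valued.v (p i) ≤ 1 := fun i => (HeightOneSpectrum.mem_adicCompletionIntegers _ _ _).1 (mem_integralBox_iff.1 hp i)
  have hmul : ∀ {a b : v.adicCompletion ↥(maximalRealSubfield L)}, Valued.v a ≤ 1 → Valued.v b ≤ 1 → Valued.v (a * b) ≤ 1 := fun ha hb => by
    rw [map_mul]; exact mul_le_one' ha hb
  have hadd : ∀ {a b : v.adicCompletion ↥(maximalRealSubfield L)}, Valued.v a ≤ 1 → Valued.v b ≤ 1 → Valued.v (a + b) ≤ 1 := fun ha hb =>
    (Valued.v.map_add _ _).trans (max_le ha hb)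
  have hsub : ∀ {a b : v.adicCompletion ↥(maximalRealSubfield L)}, Valued.v a ≤ 1 → Valued.v b ≤ 1 → Valued.v (a - b) ≤ 1 := fun ha hb =>
    (Valued.v.map_sub _ _).trans (max_le ha hb)
  have hneg : ∀ {a : v.adicCompletion ↥(maximalRealSubfield L)}, Valued.v a ≤ 1 → Valued.v (-a) ≤ 1 := fun ha => by rwa [Valuation.map_neg]
  have hx : Valued.v (p 0 + splitSqrt ↥(maximalRealSubfield L) L (IsCMField.complexConj L) hcδ hδ v w * p 1) ≤ 1 := hadd (hpi 0) (hmul hs (hpi 1))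
  have hx' : Valued.v (p 0 - splitSqrt ↥(maximalRealSubfield L) L (IsCMField.complexConj L) hcδ hδ v w * p 1) ≤ 1 := hsub (hpi 0) (hmul hs (hpi 1))
  have hz : Valued.v (splitSqrt ↥(maximalRealSubfield L) L (IsCMField.complexConj L) hcδ hδ v w * p 2 -
      2⁻¹ * (p 0 + splitSqrt ↥(maximalRealSubfield L) L (IsCMField.complexConj L) hcδ hδ v w * p 1) * (p 0 - splitSqrt ↥(maximalRealSubfield L) L (IsCMField.complexConj L) hcδ hδ v w * p 1)) ≤ 1 :=
    hsub (hmul hs (hpi 2)) (hmul (hmul h2' hx) hx')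
  have hz' : Valued.v (splitSqrt ↥(maximalRealSubfield L) L (IsCMField.complexConj L) hcδ hδ v w * p 2 -
        2⁻¹ * (p 0 + splitSqrt ↥(maximalRealSubfield L) L (IsCMField.complexConj L) hcδ hδ v w * p 1) * (p 0 - splitSqrt ↥(maximalRealSubfield L) L (IsCMField.complexConj L) hcδ hδ v w * p 1) -
      (p 0 + splitSqrt ↥(maximalRealSubfield L) L (IsCMField.complexConj L) hcδ hδ v w * p 1) * (-(p 0 - splitSqrt ↥(maximalRealSubfield L) L (IsCMField.complexConj L) hcδ hδ v w * p 1))) ≤ 1 :=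
    hsub hz (hmul hx (hneg hx'))
  exact ⟨max_eq_left (max_le (coe_normAbs_le_one_of_valued_le_one v hx) (coe_normAbs_le_one_of_valued_le_one v hz)),
    max_eq_left (max_le (coe_normAbs_le_one_of_valued_le_one v (hneg hx')) (coe_normAbs_le_one_of_valued_le_one v hz'))⟩

end Bridge

/-! ## §2 HEAD: the good split place weight -/

section Head

variable (L : Type) [Field L] [NumberField L] [IsCMField L] (hc : IsCMField.complexConj L * IsCMField.complexConj L = 1)
  {δ : L} (hcδ : IsCMField.complexConj L δ = -δ) (hδ : δ ≠ 0) {d : ↥(maximalRealSubfield L)} (hd : δ * δ = algebraMap ↥(maximalRealSubfield L) L d)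
  (v : HeightOneSpectrum (𝓞 ↥(maximalRealSubfield L)))
  [MeasurableSpace (v.adicCompletion ↥(maximalRealSubfield L))] [BorelSpace (v.adicCompletion ↥(maximalRealSubfield L))]
  (ν : Measure (v.adicCompletion ↥(maximalRealSubfield L))) [ν.IsAddHaarMeasure]

include hd in
/-- **HEAD — THE GOOD SPLIT PLACE WEIGHT.**  `v` a finite place of `L⁺` SPLIT in `L` (`w ∣ v`, `c·w ≠ w`), good (`|2|_v = 1`, `|δ|_{w'} = 1`, `φ` unramified at every `w' ∣ v`, `|𝔫|_{w'} = 1`),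
base point with `((b₁)_v)_{w'} = 1`, `φ` unitary.  THEN there is a weight `ω_v : (L⁺_v)³ → ℂ` — the product `c₁·c₂` of the pulled-back characters on the two Gindikin–Karpelevich shells
(module docstring) — with: (i) ★ p864821's SPLIT TOKEN `hsp` at `v` for every `w' ∣ v` (`1 < Re z`):
`ν(𝒪_v³)⁻¹ ∫ ω_v·Q_v^{−z} = (1−φ(ϖ_{w'})X)(1−φ(ϖ_{w̄'})X)(1−φ(ϖ_{w'})φ(ϖ_{w̄'})q·X²) ∕ ((1−φ(ϖ_{w'})qX)(1−φ(ϖ_{w̄'})qX)(1−φ(ϖ_{w'})φ(ϖ_{w̄'})q²X²))`, `X = q_v^{−z}`; (ii) the «ON»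
READING of ★ p864965 `hΩ_of_localReadings` at `v` for every `x ∈ (𝔸_{L⁺,f})³` — `evalPlace v (U x) = β·κ` (★ p865317) AND `ω_v(x|_v) = ∏_{w'∣v} φ_{w'}(t_{w'})`; (iii) `ω_v = 1` on `𝒪_v³`
(★ p864821's `hω1` at `v`). [cite: Langlands1971, §3] [cite: Rogawski1990, §4.5 p. 45, §13.9 p. 229] [cite: CasselsFrohlichANT1967, Ch. II §10] [cite: FrohlichTaylor1990, Ch. III §1 (1.14)(a)]
[cite: TateThesis1967, §2.3, §2.5] -/
theorem exists_goodSplit_weight {φ : HeckeCharacter L} (hφ : φ.IsUnitary) (𝔫 : Ideal (𝓞 L)) (w : PlacesOver L v) (hw : IsCMField.complexConj L • w.1 ≠ w.1)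
    (h2 : Valued.v (2 : v.adicCompletion ↥(maximalRealSubfield L)) = 1) (hδu : ∀ w' : PlacesOver L v, Valued.v (algebraMap L (LocalRing L v) δ w') = 1)
    (hur : ∀ w' : PlacesOver L v, φ.IsUnramifiedAt w'.1) (h𝔫 : ∀ w' : PlacesOver L v, idealRadius L w'.1 𝔫 = 1)
    (b₁ : ↥(finAdelic (↥(maximalRealSubfield L)) L (IsCMField.complexConj L) 3 ((StdForm.antidiagonal 3).over L)))
    (hb₁ : ∀ w' : PlacesOver L v, ((((evalPlace (↥(maximalRealSubfield L)) L (IsCMField.complexConj L) 3 ((StdForm.antidiagonal 3).over L) v b₁ : localPi L (IsCMField.complexConj L) 3 ((StdForm.antidiagonal 3).over L) v) : LocalGLPi L 3 v) w' :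
      GL (Fin 3) (w'.1.adicCompletion L)) : Matrix (Fin 3) (Fin 3) (w'.1.adicCompletion L)) = 1) :
    ∃ ωv : (Fin 3 → v.adicCompletion ↥(maximalRealSubfield L)) → ℂ,
      -- (i) ★ p864821's split token `hsp` at `v`, for every `w' ∣ v`
      (∀ z : ℂ, 1 < z.re → ∀ w' : PlacesOver L v, IsCMField.complexConj L • w'.1 ≠ w'.1 →
        ((Measure.pi fun _ : Fin 3 => ν) (integralBox ↥(maximalRealSubfield L) (Fin 3) v)).toReal⁻¹ •
            ∫ p : Fin 3 → v.adicCompletion ↥(maximalRealSubfield L),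
              ωv p * (((∏ w' : PlacesOver L v, max 1 (max ((normAbs (w'.1.adicCompletion L) (quadraticLocalEquiv L v (IsCMField.complexConj L) hcδ hδ (p 0, p 1) w') : ℝ≥0) : ℝ)
                ((normAbs (w'.1.adicCompletion L) ((toLocalRing L v (p 2) * algebraMap L (LocalRing L v) δ -
                  toLocalRing L v 2⁻¹ * (quadraticLocalEquiv L v (IsCMField.complexConj L) hcδ hδ (p 0, p 1) *
                    conjLocal L (IsCMField.complexConj L) v (quadraticLocalEquiv L v (IsCMField.complexConj L) hcδ hδ (p 0, p 1)))) w') : ℝ≥0) : ℝ))) : ℝ) : ℂ) ^ (-z)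
              ∂(Measure.pi fun _ : Fin 3 => ν) =
          (1 - φ.valueAtUniformizer w'.1 * (v.residueCard : ℂ) ^ (-z)) * (1 - φ.valueAtUniformizer (PlacesOver.galInv (IsCMField.complexConj L) w').1 * (v.residueCard : ℂ) ^ (-z)) *
              (1 - φ.valueAtUniformizer w'.1 * φ.valueAtUniformizer (PlacesOver.galInv (IsCMField.complexConj L) w').1 * (v.residueCard : ℂ) ^ (-(2 * z - 1))) /
            ((1 - φ.valueAtUniformizer w'.1 * (v.residueCard : ℂ) ^ (-(z - 1))) * (1 - φ.valueAtUniformizer (PlacesOver.galInv (IsCMField.complexConj L) w').1 * (v.residueCard : ℂ) ^ (-(z - 1))) *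
              (1 - φ.valueAtUniformizer w'.1 * φ.valueAtUniformizer (PlacesOver.galInv (IsCMField.complexConj L) w').1 * (v.residueCard : ℂ) ^ (-(2 * z - 2))))) ∧
      -- (ii) the «on» reading of ★ `hΩ_of_localReadings` at `v`, for every `x`
      (∀ x : Fin 3 → FiniteAdeleRing (𝓞 ↥(maximalRealSubfield L)) ↥(maximalRealSubfield L),
        ∃ (β κ : localPi L (IsCMField.complexConj L) 3 ((StdForm.antidiagonal 3).over L) v) (t : ∀ w' : PlacesOver L v, (w'.1.adicCompletion L)ˣ),
          (∀ w' : PlacesOver L v, ((((β : localPi L (IsCMField.complexConj L) 3 ((StdForm.antidiagonal 3).over L) v) : LocalGLPi L 3 v) w' : GL (Fin 3) (w'.1.adicCompletion L)) :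
            Matrix (Fin 3) (Fin 3) (w'.1.adicCompletion L)).BlockTriangular id) ∧
          (∀ w' : PlacesOver L v, ((κ : localPi L (IsCMField.complexConj L) 3 ((StdForm.antidiagonal 3).over L) v) : LocalGLPi L 3 v) w' ∈ valuedCongruenceSubgroup (Fin 3) (idealRadius L w'.1 𝔫)) ∧
          evalPlace (↥(maximalRealSubfield L)) L (IsCMField.complexConj L) 3 ((StdForm.antidiagonal 3).over L) v
            (finPart (↥(maximalRealSubfield L)) L (IsCMField.complexConj L) 3 ((StdForm.antidiagonal 3).over L)
              ((quasiSplit (↥(maximalRealSubfield L)) L (IsCMField.complexConj L) 3).toAdelic (weylLongU ((IsCMField.complexConj L : L ≃ₐ[↥(maximalRealSubfield L)] L) : L →+* L) (rfl : (StdForm.antidiagonal 3).over L = (StdForm.antidiagonal 3).over L)) *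
                ((heisChart hc (((((0 : InfiniteAdeleRing L)), quadraticFiniteAdeleMap ↥(maximalRealSubfield L) L δ (x 0, x 1)) : AdeleRing (𝓞 L) L),
                  traceZeroLine ↥(maximalRealSubfield L) L (IsCMField.complexConj L) hcδ hδ ((0, x 2) : AdeleRing (𝓞 ↥(maximalRealSubfield L)) ↥(maximalRealSubfield L))) :
                    ↥(adelicUnipotent ↥(maximalRealSubfield L) L (IsCMField.complexConj L) 3)) : (quasiSplit (↥(maximalRealSubfield L)) L (IsCMField.complexConj L) 3).Adelic)) * b₁) = β * κ ∧
          (∀ w' : PlacesOver L v, ((t w' : (w'.1.adicCompletion L)ˣ) : w'.1.adicCompletion L) =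
            ((((β : localPi L (IsCMField.complexConj L) 3 ((StdForm.antidiagonal 3).over L) v) : LocalGLPi L 3 v) w' : GL (Fin 3) (w'.1.adicCompletion L)) : Matrix (Fin 3) (Fin 3) (w'.1.adicCompletion L)) 0 0) ∧
          ωv (fun i => x i v) = ∏ w' : PlacesOver L v, ((φ.localComponent w'.1 (t w') : ℂˣ) : ℂ)) ∧
      -- (iii) the weight is `1` on the box `𝒪_v³` (★ p864821's `hω1` at `v`)
      (∀ p ∈ integralBox ↥(maximalRealSubfield L) (Fin 3) v, ωv p = 1) := by
  classical
  haveI : Algebra.IsQuadraticExtension ↥(maximalRealSubfield L) L := IsCMField.isQuadraticExtension L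
  have hc1 : IsCMField.complexConj L ≠ 1 := IsCMField.complexConj_ne_one L
  have hwb : IsCMField.complexConj L • (PlacesOver.galInv (IsCMField.complexConj L) w).1 ≠ (PlacesOver.galInv (IsCMField.complexConj L) w).1 :=
    smul_galInv_ne L (IsCMField.complexConj L) hcδ hδ v w hw
  have hne : PlacesOver.galInv (IsCMField.complexConj L) w ≠ w := PlacesOver.galInv_ne (IsCMField.complexConj L) w hw
  have huniv : (Finset.univ : Finset (PlacesOver L v)) = {w, PlacesOver.galInv (IsCMField.complexConj L) w} := by
    ext w'
    simp only [Finset.mem_univ, Finset.mem_insert, Finset.mem_singleton, true_iff]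
    exact PlacesOver.eq_or_eq_galInv (IsCMField.complexConj L) hc1 w w'
  -- ★ p865317: the split «on» reading with the brick's torus-entry functions `αL₁ αL₂` over `L_w`
  obtain ⟨αL₁, αL₂, hAL, hBL, hread⟩ := exists_goodSplit_reading L hc hcδ hδ v 𝔫 w hw h𝔫 b₁ hb₁
  -- the degree-one bridge `ι_w : L⁺_v ≃ L_w` on units
  obtain ⟨he, hf⟩ := ramificationIdx_eq_one_and_inertiaDeg_eq_one_of_smul_ne ↥(maximalRealSubfield L) (IsCMField.complexConj L) hw
  haveI := PlacesOver.liesOver w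
  have hval_symm : ∀ z : (w.1.adicCompletion L)ˣ,
      toPlace v w (((unitsAdicCompletionEquivOfDegreeOne ↥(maximalRealSubfield L) L v w.1 he hf).symm z : (v.adicCompletion ↥(maximalRealSubfield L))ˣ) : v.adicCompletion ↥(maximalRealSubfield L)) =
        (z : w.1.adicCompletion L) := fun z => by
    rw [coe_unitsAdicCompletionEquivOfDegreeOne_symm]
    exact (adicCompletionEquivOfDegreeOne ↥(maximalRealSubfield L) L v w.1 he hf).apply_symm_apply _
  -- the pulled-back torus-entry functions `α₁ α₂ : (L⁺_v)³ → (L⁺_v)^×`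
  obtain ⟨α₁, hα₁v, hα₁m⟩ : ∃ α : (Fin 3 → v.adicCompletion ↥(maximalRealSubfield L)) → (v.adicCompletion ↥(maximalRealSubfield L))ˣ,
      (∀ p, toPlace v w (α p : v.adicCompletion ↥(maximalRealSubfield L)) = (αL₁ (fun i => toPlace v w (p i)) : w.1.adicCompletion L)) ∧
      (∀ p, Units.map (toPlace v w).toMonoidHom (α p) = αL₁ (fun i => toPlace v w (p i))) :=
    ⟨fun p => (unitsAdicCompletionEquivOfDegreeOne ↥(maximalRealSubfield L) L v w.1 he hf).symm (αL₁ (fun i => toPlace v w (p i))), fun p => hval_symm _, fun p => Units.ext (hval_symm _)⟩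
  obtain ⟨α₂, hα₂v, hα₂m⟩ : ∃ α : (Fin 3 → v.adicCompletion ↥(maximalRealSubfield L)) → (v.adicCompletion ↥(maximalRealSubfield L))ˣ,
      (∀ p, toPlace v w (α p : v.adicCompletion ↥(maximalRealSubfield L)) = (αL₂ (fun i => toPlace v w (p i)) : w.1.adicCompletion L)) ∧
      (∀ p, Units.map (toPlace v w).toMonoidHom (α p) = αL₂ (fun i => toPlace v w (p i))) :=
    ⟨fun p => (unitsAdicCompletionEquivOfDegreeOne ↥(maximalRealSubfield L) L v w.1 he hf).symm (αL₂ (fun i => toPlace v w (p i))), fun p => hval_symm _, fun p => Units.ext (hval_symm _)⟩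
  -- the pulled-back unramified characters `χ_A = φ_{w̄} ∘ c⁻¹_* ∘ ι_w`, `χ_B = φ_w ∘ ι_w`
  obtain ⟨χA, hχA⟩ : ∃ χ : (v.adicCompletion ↥(maximalRealSubfield L))ˣ →* ℂˣ, ∀ u, χ u = φ.localComponent (PlacesOver.galInv (IsCMField.complexConj L) w).1
      (Units.map ((galAdicCompletionMap (IsCMField.complexConj L)⁻¹ (rfl : (IsCMField.complexConj L)⁻¹ • w.1 = (PlacesOver.galInv (IsCMField.complexConj L) w).1)).toMonoidHom.comp
        (toPlace v w).toMonoidHom) u) :=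
    ⟨(φ.localComponent (PlacesOver.galInv (IsCMField.complexConj L) w).1).comp (Units.map ((galAdicCompletionMap (IsCMField.complexConj L)⁻¹
      (rfl : (IsCMField.complexConj L)⁻¹ • w.1 = (PlacesOver.galInv (IsCMField.complexConj L) w).1)).toMonoidHom.comp (toPlace v w).toMonoidHom)), fun u => rfl⟩
  obtain ⟨χB, hχB⟩ : ∃ χ : (v.adicCompletion ↥(maximalRealSubfield L))ˣ →* ℂˣ, ∀ u, χ u = φ.localComponent w.1 (Units.map (toPlace v w).toMonoidHom u) :=
    ⟨(φ.localComponent w.1).comp (Units.map (toPlace v w).toMonoidHom), fun u => rfl⟩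
  -- the Gindikin–Karpelevich maxima over `L⁺_v` (base `δ_w`)
  obtain ⟨A, hA⟩ : ∃ A : (Fin 3 → v.adicCompletion ↥(maximalRealSubfield L)) → ℝ, ∀ p, A p =
      max 1 (max ((normAbs (v.adicCompletion ↥(maximalRealSubfield L)) (p 0 + splitSqrt ↥(maximalRealSubfield L) L (IsCMField.complexConj L) hcδ hδ v w * p 1) : ℝ≥0) : ℝ)
        ((normAbs (v.adicCompletion ↥(maximalRealSubfield L)) (splitSqrt ↥(maximalRealSubfield L) L (IsCMField.complexConj L) hcδ hδ v w * p 2 -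
          2⁻¹ * (p 0 + splitSqrt ↥(maximalRealSubfield L) L (IsCMField.complexConj L) hcδ hδ v w * p 1) * (p 0 - splitSqrt ↥(maximalRealSubfield L) L (IsCMField.complexConj L) hcδ hδ v w * p 1)) : ℝ≥0) : ℝ)) :=
    ⟨_, fun p => rfl⟩
  obtain ⟨B, hB⟩ : ∃ B : (Fin 3 → v.adicCompletion ↥(maximalRealSubfield L)) → ℝ, ∀ p, B p =
      max 1 (max ((normAbs (v.adicCompletion ↥(maximalRealSubfield L)) (-(p 0 - splitSqrt ↥(maximalRealSubfield L) L (IsCMField.complexConj L) hcδ hδ v w * p 1)) : ℝ≥0) : ℝ)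
        ((normAbs (v.adicCompletion ↥(maximalRealSubfield L)) (splitSqrt ↥(maximalRealSubfield L) L (IsCMField.complexConj L) hcδ hδ v w * p 2 -
            2⁻¹ * (p 0 + splitSqrt ↥(maximalRealSubfield L) L (IsCMField.complexConj L) hcδ hδ v w * p 1) * (p 0 - splitSqrt ↥(maximalRealSubfield L) L (IsCMField.complexConj L) hcδ hδ v w * p 1) -
          (p 0 + splitSqrt ↥(maximalRealSubfield L) L (IsCMField.complexConj L) hcδ hδ v w * p 1) * (-(p 0 - splitSqrt ↥(maximalRealSubfield L) L (IsCMField.complexConj L) hcδ hδ v w * p 1))) : ℝ≥0) : ℝ)) :=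
    ⟨_, fun p => rfl⟩
  -- the shell weights `c₁ c₂` and `ω_v := c₁·c₂`
  obtain ⟨c₁, hc₁⟩ : ∃ c : (Fin 3 → v.adicCompletion ↥(maximalRealSubfield L)) → ℂ, ∀ p, c p = if 1 < A p then ((χA (α₁ p) : ℂˣ) : ℂ) else 1 := ⟨_, fun p => rfl⟩
  obtain ⟨c₂, hc₂⟩ : ∃ c : (Fin 3 → v.adicCompletion ↥(maximalRealSubfield L)) → ℂ, ∀ p, c p = if 1 < B p then ((χB (α₂ p) : ℂˣ) : ℂ) else 1 := ⟨_, fun p => rfl⟩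
  -- (α): the pulled-back torus-entry letters (★ p865317's letters read through `ι_w`)
  have hnα₁ : ∀ p, ((normAbs (v.adicCompletion ↥(maximalRealSubfield L)) (α₁ p : v.adicCompletion ↥(maximalRealSubfield L)) : ℝ≥0) : ℝ) =
      ((normAbs (w.1.adicCompletion L) (αL₁ (fun i => toPlace v w (p i)) : w.1.adicCompletion L) : ℝ≥0) : ℝ) := fun p => by
    rw [← normAbs_toPlace_of_split L (IsCMField.complexConj L) v w hw, hα₁v]
  have hnα₂ : ∀ p, ((normAbs (v.adicCompletion ↥(maximalRealSubfield L)) (α₂ p : v.adicCompletion ↥(maximalRealSubfield L)) : ℝ≥0) : ℝ) =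
      ((normAbs (w.1.adicCompletion L) (αL₂ (fun i => toPlace v w (p i)) : w.1.adicCompletion L) : ℝ≥0) : ℝ) := fun p => by
    rw [← normAbs_toPlace_of_split L (IsCMField.complexConj L) v w hw, hα₂v]
  have hAα : ∀ p, ((normAbs (v.adicCompletion ↥(maximalRealSubfield L)) (α₁ p : v.adicCompletion ↥(maximalRealSubfield L)) : ℝ≥0) : ℝ) * A p = 1 := fun p => by
    rw [hnα₁, hA, gkMaxA_eq_toPlace L hcδ hδ hd w hw p]
    exact hAL _
  have hBα : ∀ p, ((normAbs (v.adicCompletion ↥(maximalRealSubfield L)) (α₂ p : v.adicCompletion ↥(maximalRealSubfield L)) : ℝ≥0) : ℝ) * B p = 1 := fun p => by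
    rw [hnα₂, hB, gkMaxB_eq_toPlace L hcδ hδ hd w hw p]
    exact hBL _
  -- on the trivial shells the torus entries are units, so the unramified characters are `1` there
  have hA1 : ∀ p, ¬ 1 < A p → normAbs (w.1.adicCompletion L) (αL₁ (fun i => toPlace v w (p i)) : w.1.adicCompletion L) = 1 := fun p hp => by
    have hA1 : A p = 1 := le_antisymm (not_lt.1 hp) (by rw [hA]; exact le_max_left _ _)
    have h := hAα p
    rw [hA1, mul_one, hnα₁] at h
    exact_mod_cast h
  have hB1 : ∀ p, ¬ 1 < B p → normAbs (w.1.adicCompletion L) (αL₂ (fun i => toPlace v w (p i)) : w.1.adicCompletion L) = 1 := fun p hp => by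
    have hB1 : B p = 1 := le_antisymm (not_lt.1 hp) (by rw [hB]; exact le_max_left _ _)
    have h := hBα p
    rw [hB1, mul_one, hnα₂] at h
    exact_mod_cast h
  refine ⟨fun p => c₁ p * c₂ p, fun z hz w' _ => ?_, fun x => ?_, fun p hp => ?_⟩
  · -- (i) the split token, through the SYMMETRIC token of ★ `chiLocalMean_eq_splitToken_of_torusEntries` at `(χ_A, α₁, A) ⊗ (χ_B, α₂, B)`
    have key := chiLocalMean_eq_splitToken_of_torusEntries L hcδ hδ hd v ν w hw h2 (hδu w) χA χB
      (fun u hu => by rw [hχA]; exact localComponent_galInv_map_toPlace_eq_one L w hw (hur _) u hu)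
      (fun u hu => by rw [hχB]; exact localComponent_map_toPlace_eq_one L w hw (hur _) u hu)
      (HeckeCharacter.uniformizer ↥(maximalRealSubfield L) v) (normAbs_heckeUniformizer ↥(maximalRealSubfield L) v)
      (by rw [hχA]; exact localComponent_galInv_map_toPlace_uniformizer L w hw (hur _) (HeckeCharacter.valued_uniformizer (K := ↥(maximalRealSubfield L)) v))
      (by rw [hχB]; exact localComponent_map_toPlace_uniformizer L w hw (hur _) (HeckeCharacter.valued_uniformizer (K := ↥(maximalRealSubfield L)) v))
      (HeckeCharacter.norm_valueAtUniformizer_of_isUnitary hφ _) (HeckeCharacter.norm_valueAtUniformizer_of_isUnitary hφ _)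
      α₁ α₂ (fun p _ => by rw [← hA]; exact hAα p) (fun p _ => by rw [← hB]; exact hBα p) c₁ c₂ (fun p => c₁ p * c₂ p)
      (fun p hp => by rw [hc₁, if_neg (by rw [hA, hp]; exact lt_irrefl 1)]) (fun p hp => by rw [hc₁, if_pos (by rwa [hA])])
      (fun p hp => by rw [hc₂, if_neg (by rw [hB, hp]; exact lt_irrefl 1)]) (fun p hp => by rw [hc₂, if_pos (by rwa [hB])]) (fun _ => rfl) hz
    rcases PlacesOver.eq_or_eq_galInv (IsCMField.complexConj L) hc1 w w' with rfl | rfl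
    · rw [key]
      ring
    · rw [PlacesOver.galInv_galInv (IsCMField.complexConj L) hc1]
      exact key
  · -- (ii) the «on» reading: ★ p865317's `β κ t`, and `ω_v(x|_v) = φ_w(t_w)·φ_{w̄}(t_{w̄})`
    obtain ⟨β, κ, t, hβ, hκ, hprod, ht, htw, htwb⟩ := hread x
    refine ⟨β, κ, t, hβ, hκ, hprod, ht, ?_⟩
    have h₂ : c₂ (fun i => x i v) = ((φ.localComponent w.1 (t w) : ℂˣ) : ℂ) := by
      by_cases hBx : 1 < B (fun i => x i v)
      · have hU : Units.map (toPlace v w).toMonoidHom (α₂ fun i => x i v) = t w := by rw [htw]; exact hα₂m _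
        rw [hc₂, if_pos hBx, hχB, hU]
      · have h1 : φ.localComponent w.1 (t w) = 1 := by
          refine localComponent_eq_one_of_normAbs_eq_one w.1 (hur w) (t w) ?_
          rw [htw]
          exact hB1 _ hBx
        rw [hc₂, if_neg hBx, h1, Units.val_one]
    have h₁ : c₁ (fun i => x i v) = ((φ.localComponent (PlacesOver.galInv (IsCMField.complexConj L) w).1 (t (PlacesOver.galInv (IsCMField.complexConj L) w)) : ℂˣ) : ℂ) := by
      by_cases hAx : 1 < A (fun i => x i v)
      · have hU : Units.map ((galAdicCompletionMap (IsCMField.complexConj L)⁻¹ (rfl : (IsCMField.complexConj L)⁻¹ • w.1 = (PlacesOver.galInv (IsCMField.complexConj L) w).1)).toMonoidHom.comp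
            (toPlace v w).toMonoidHom) (α₁ fun i => x i v) = t (PlacesOver.galInv (IsCMField.complexConj L) w) := by
          refine Units.ext ?_
          rw [Units.coe_map, MonoidHom.coe_comp, Function.comp_apply, RingHom.toMonoidHom_eq_coe, MonoidHom.coe_coe, RingHom.toMonoidHom_eq_coe, MonoidHom.coe_coe, hα₁v, htwb]
        rw [hc₁, if_pos hAx, hχA, hU]
      · have h1 : φ.localComponent (PlacesOver.galInv (IsCMField.complexConj L) w).1 (t (PlacesOver.galInv (IsCMField.complexConj L) w)) = 1 := by
          refine localComponent_eq_one_of_normAbs_eq_one _ (hur _) _ (normAbs_eq_one_of_valued_eq_one _ ?_)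
          rw [htwb, valued_galAdicCompletionMap]
          exact valued_eq_one_of_normAbs_eq_one w.1 (hA1 _ hAx)
        rw [hc₁, if_neg hAx, h1, Units.val_one]
    show c₁ (fun i => x i v) * c₂ (fun i => x i v) = _
    rw [huniv, Finset.prod_pair hne.symm, h₁, h₂, mul_comm]
  · -- (iii) on the box both shells are trivial
    obtain ⟨hA1', hB1'⟩ := gkMax_eq_one_of_mem_integralBox L hcδ hδ hd w hw h2 (hδu w) hp
    show c₁ p * c₂ p = 1
    rw [hc₁, hc₂, if_neg (by rw [hA, hA1']; exact lt_irrefl 1), if_neg (by rw [hB, hB1']; exact lt_irrefl 1), one_mul]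

end Head

end Summit.HodgeConjecture.HodgeConjecture.Cruxes.H413.K2E1ChiGoodSplitWeightU3

end
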